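import Summits.QuantumFields.GaugeBoot.ClassBRPClosure
import Summits.QuantumFields.GaugeBoot.ClassBLimitLinkGeometry
import HarnessLib

/-!
# The covariant (Osterwalder–Seiler half-link) form of link reflection positivity on `ℤ^d` (gauge-boot, Class-B brick)

HONEST FRAMING (cell `pub-gaugeboot`, page 1 of every file): the venture produces certified bounds
on lattice expectations at stated coupling, gauge group, dimension and torus size; NOT a mass gap,
NOT a continuum limit, NOT a string tension; NOT Yang–Mills-summit-bearing (barriers
`FixedCouplingUltralocality`, `PerturbativeInvisibility`). Structural bookkeeping for the Class-B
column (SCOPING A18); this module certifies no number and asserts nothing about any state.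

## Why

The `linkRP` field of `ClassBState` (`ClassB.lean`) is PLAIN link reflection positivity: the
pairing `∫ (F∘Θ)‾ F dμ ≥ 0` for observables `F` supported on links with both endpoints in the
closed half `{x_i ≥ 1}` of the mirror `x_i = ½`. For a gauge-invariant state this licenses the
two-loop `R_link` blocks `⟨W(θC_a)‾ W(C_b)⟩` of loops NOT touching the mirror. Kazakov–Zheng's
link-type positivity matrices (arXiv:2203.11360 §3.1: Wilson paths ending ON the hyperplane through
the middles of links, glued through the crossing links into the single loops
`tr ρ(U_c · P_b · U_{c'}⁻¹ · (θP_a)⁻¹)`) need MORE: the covariant ("half-link") form of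
Osterwalder–Seiler link positivity, in which the crossing link variables are split `U_c = h_c Y_c`
(Osterwalder–Seiler 1978 §2; Seiler LNP 159 Ch. 2). On the torus the tree has it:
`wilsonExpectation_nonneg_of_covariant` (even side, `ConstructiveQFTWave0CovariantRPProofs`) and
`wilsonExpectation_nonneg_of_oddCovariant` (odd side, `ConstructiveQFTWave0OddRPProofs`), consumed by
lean1's `WordLinkRP` for the Class-A link blocks. This module states the same property for a
measure on the configurations `LGConfig d G` of the INFINITE lattice, as a predicate:

* `linkCrossEdges i = {(x, i) : x_i = 0}` — the links crossing the mirror `x_i = ½`;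
  `configCrossTranslate i Y U` — the substitution `U_c ↦ U_c · Y_c` on the crossing links;
  `configCrossSplice i U Y` — the configuration `z = splice_C(U, Y)` (crossing links from `Y`, the
  rest from `U`);
* **`IsCovariantLinkRP i μ`**: for finitely many bounded measurable cylinder observables `g_k`
  supported on `linkHalfEdges i ∪ linkCrossEdges i` and every bounded continuous cylinder
  observable `Φ` with `Φ (configCrossTranslate i Y U) = Σ_k g_k (configCrossSplice i U Y) ·
  conj (g_k (configLinkReflect i U))` for all `U, Y`: `0 ≤ ∫ Φ dμ`;
* `configLinkReflect_apply_of_mem_linkCrossEdges` (`(Θ_i U)_c = U_c⁻¹` on crossing links),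
  `configLinkReflect_configCrossTranslate_apply_of_not_mem` (`Θ_i ∘ T_Y` and `Θ_i` agree off the
  crossing links), `configCrossTranslate_one` (`Y = 1` is the identity, so `Φ` is DETERMINED by the
  `g_k`: `apply_eq_sum_of_covariant`);
* `IsCovariantLinkRP.nonneg_of_fintype` — any finite index type;
* `IsCovariantLinkRP.integral_conj_mul_nonneg_of_cylinder` — the plain pairing of a bounded
  continuous cylinder observable of the half is the case `g = F`;
  **`IsCovariantLinkRP.linkRP`** — for a probability measure preserved by `Θ_i`, the covariant
  property implies `ClassB.lean`'s `IsReflectionPositiveFor (configLinkReflect i) (linkHalfEdges i)`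
  (all bounded measurable half observables, via `IsReflectionPositiveFor.of_continuous_cylinder`).

Sequels: `ClassBLimitCovariantLinkRP.lean` (every infinite-volume limit point of the torus Wilson
states has `IsCovariantLinkRP i` in every axis, `β ≥ 0`), `ClassBLinkCutWordBlocks.lean` (the
Kazakov–Zheng cut-loop `R_link` word blocks of such a state are PSD). Nothing here is claimed for a
general `ClassBState` (whose `linkRP` axiom is the plain form). [folklore] mechanism.

References: K. Osterwalder, E. Seiler, Ann. Phys. 110 (1978) 440, §2; E. Seiler, LNP 159 (1982)
Ch. 2; V. Kazakov, Z. Zheng, arXiv:2203.11360 §3.1; I. Montvay, G. Münster (1994) §3.2.4.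
-/

noncomputable section

open MeasureTheory Complex
open scoped ComplexOrder ComplexConjugate
open Literature.Probability.LatticeModels (Site)
open Literature.MathematicalPhysics.QuantumLattice

namespace Summit.QuantumFields.GaugeBoot

variable {d N : ℕ} {G : Type*}

/-! ## Crossing links; the substitution and the splice -/

section Defs

/-- The links CROSSING the link mirror `x_i = ½`: the direction-`i` links `x → x + e_i` with
`x_i = 0`. They belong neither to the closed half `linkHalfEdges i = {x_i ≥ 1}` nor to its mirror
image. [folklore] -/
def linkCrossEdges (i : Fin d) : Set (ZdEdge d) := {e | e.2 = i ∧ e.1 i = 0}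

/-- Membership in `linkCrossEdges`, unfolded. -/
theorem mem_linkCrossEdges {i : Fin d} {e : ZdEdge d} :
    e ∈ linkCrossEdges i ↔ e.2 = i ∧ e.1 i = 0 := Iff.rfl

/-- A link of the closed half `{x_i ≥ 1}` is not a crossing link. -/
theorem not_mem_linkCrossEdges_of_mem_linkHalfEdges {i : Fin d} {e : ZdEdge d}
    (he : e ∈ linkHalfEdges i) : e ∉ linkCrossEdges i := by
  intro h
  have h1 : (1 : ℤ) ≤ e.1 i := he
  rw [h.2] at h1
  exact absurd h1 (by norm_num)

/-- The spliced configuration `z = splice_C(U, Y)`: the crossing links are read from `Y`, all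
other links from `U` (the `ℤ^d` form of `LatticeRP.splice crossEdges (U, Y)`). [folklore] -/
def configCrossSplice (i : Fin d) (U Y : LGConfig d G) : LGConfig d G := fun e =>
  if e.2 = i ∧ e.1 i = 0 then Y e else U e

/-- `configCrossSplice` on a crossing link. -/
theorem configCrossSplice_apply_of_mem {i : Fin d} (U Y : LGConfig d G) {e : ZdEdge d}
    (he : e ∈ linkCrossEdges i) : configCrossSplice i U Y e = Y e := if_pos he

/-- `configCrossSplice` off the crossing links. -/
theorem configCrossSplice_apply_of_not_mem {i : Fin d} (U Y : LGConfig d G) {e : ZdEdge d}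
    (he : e ∉ linkCrossEdges i) : configCrossSplice i U Y e = U e := if_neg he

/-- An observable supported away from the crossing links does not see the splice. -/
theorem apply_configCrossSplice_eq {α : Type*} {F : LGConfig d G → α} {S : Set (ZdEdge d)}
    (hF : DependsOn F S) {i : Fin d} (hS : ∀ e ∈ S, e ∉ linkCrossEdges i) (U Y : LGConfig d G) :
    F (configCrossSplice i U Y) = F U :=
  hF fun e he => configCrossSplice_apply_of_not_mem U Y (hS e he)

variable [Group G]

/-- The Osterwalder–Seiler substitution splitting the crossing link variables:
`U_c ↦ U_c · Y_c` on the links crossing `x_i = ½`, all other links unchanged (the `ℤ^d` form of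
`WilsonRP.translate` / `WilsonOddRP.translateLow`; `Y_c` is the half of the link variable on the
positive side of the mirror). [folklore] -/
def configCrossTranslate (i : Fin d) (Y U : LGConfig d G) : LGConfig d G := fun e =>
  if e.2 = i ∧ e.1 i = 0 then U e * Y e else U e

/-- `configCrossTranslate` on a crossing link. -/
theorem configCrossTranslate_apply_of_mem {i : Fin d} (Y U : LGConfig d G) {e : ZdEdge d}
    (he : e ∈ linkCrossEdges i) : configCrossTranslate i Y U e = U e * Y e := if_pos he

/-- `configCrossTranslate` off the crossing links. -/
theorem configCrossTranslate_apply_of_not_mem {i : Fin d} (Y U : LGConfig d G) {e : ZdEdge d}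
    (he : e ∉ linkCrossEdges i) : configCrossTranslate i Y U e = U e := if_neg he

/-- `Y = 1` is the identity substitution. -/
@[simp] theorem configCrossTranslate_one (i : Fin d) (U : LGConfig d G) :
    configCrossTranslate i 1 U = U := by
  funext e
  by_cases he : e.2 = i ∧ e.1 i = 0
  · simp [configCrossTranslate, he]
  · simp [configCrossTranslate, he]

/-- An observable supported away from the crossing links does not see the substitution. -/
theorem apply_configCrossTranslate_eq {α : Type*} {F : LGConfig d G → α} {S : Set (ZdEdge d)}
    (hF : DependsOn F S) {i : Fin d} (hS : ∀ e ∈ S, e ∉ linkCrossEdges i) (Y U : LGConfig d G) :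
    F (configCrossTranslate i Y U) = F U :=
  hF fun e he => configCrossTranslate_apply_of_not_mem Y U (hS e he)

end Defs

/-! ## The link reflection on and off the crossing links -/

section Reflect

variable [Group G]

/-- For a site of the layer `x_i = 0`: `θ x - e_i = x` (`θ` the link reflection `x_i ↦ 1 - x_i`). -/
theorem zdLinkReflect_sub_single_of_apply_eq_zero {i : Fin d} {x : Site d} (hx : x i = 0) :
    zdLinkReflect i x - Pi.single i 1 = x := by
  ext k
  by_cases hk : k = i
  · subst hk; simp [zdLinkReflect, hx]
  · simp [zdLinkReflect, hk]

/-- **On a crossing link the reflected configuration is the inverse**: `(Θ_i U)_c = U_c⁻¹`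
(the crossing link is mapped onto itself, reversed). -/
theorem configLinkReflect_apply_of_mem_linkCrossEdges {i : Fin d} (U : LGConfig d G) {e : ZdEdge d}
    (he : e ∈ linkCrossEdges i) : configLinkReflect i U e = (U e)⁻¹ := by
  obtain ⟨x, k⟩ := e
  obtain ⟨hk, hx⟩ := he
  simp only at hk hx
  subst hk
  rw [configLinkReflect_apply, if_pos rfl, zdLinkReflect_sub_single_of_apply_eq_zero hx]

/-- The link read by `Θ_i` at a non-crossing link is a non-crossing link (direction `i`). -/
theorem linkReflect_source_not_mem {i : Fin d} {e : ZdEdge d} (he : e ∉ linkCrossEdges i)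
    (h2 : e.2 = i) : (zdLinkReflect i e.1 - Pi.single i 1, i) ∉ linkCrossEdges (d := d) i := by
  rintro ⟨-, h0⟩
  apply he
  refine ⟨h2, ?_⟩
  have h0' : (zdLinkReflect i e.1 - Pi.single i 1 : Site d) i = 0 := h0
  simp only [Pi.sub_apply, zdLinkReflect, Function.update_self, Pi.single_eq_same] at h0'
  linarith

/-- The link read by `Θ_i` at a link of direction `k ≠ i` is not a crossing link. -/
theorem linkReflect_source_not_mem' {i : Fin d} {e : ZdEdge d} (h2 : e.2 ≠ i) :
    (zdLinkReflect i e.1, e.2) ∉ linkCrossEdges (d := d) i := fun h => h2 h.1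

/-- **`Θ_i ∘ T_Y` and `Θ_i` agree off the crossing links.** -/
theorem configLinkReflect_configCrossTranslate_apply_of_not_mem {i : Fin d} (Y U : LGConfig d G)
    {e : ZdEdge d} (he : e ∉ linkCrossEdges i) :
    configLinkReflect i (configCrossTranslate i Y U) e = configLinkReflect i U e := by
  rw [configLinkReflect_apply, configLinkReflect_apply]
  by_cases h2 : e.2 = i
  · rw [if_pos h2, if_pos h2,
      configCrossTranslate_apply_of_not_mem Y U (linkReflect_source_not_mem he h2)]
  · rw [if_neg h2, if_neg h2, configCrossTranslate_apply_of_not_mem Y U (linkReflect_source_not_mem' h2)]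

/-- On a crossing link: `(Θ_i (T_Y U))_c = Y_c⁻¹ · (Θ_i U)_c` (the substitution acts on the
reflected side by `Y⁻¹` from the left). -/
theorem configLinkReflect_configCrossTranslate_apply_of_mem {i : Fin d} (Y U : LGConfig d G)
    {e : ZdEdge d} (he : e ∈ linkCrossEdges i) :
    configLinkReflect i (configCrossTranslate i Y U) e = (Y e)⁻¹ * configLinkReflect i U e := by
  rw [configLinkReflect_apply_of_mem_linkCrossEdges _ he,
    configLinkReflect_apply_of_mem_linkCrossEdges _ he, configCrossTranslate_apply_of_mem Y U he,
    mul_inv_rev]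

/-- An observable supported away from the crossing links reads `Θ_i (T_Y U)` as `Θ_i U`. -/
theorem apply_configLinkReflect_configCrossTranslate_eq {α : Type*} {F : LGConfig d G → α}
    {S : Set (ZdEdge d)} (hF : DependsOn F S) {i : Fin d} (hS : ∀ e ∈ S, e ∉ linkCrossEdges i)
    (Y U : LGConfig d G) :
    F (configLinkReflect i (configCrossTranslate i Y U)) = F (configLinkReflect i U) :=
  hF fun e he => configLinkReflect_configCrossTranslate_apply_of_not_mem Y U (hS e he)

/-- **The covariance identity at `Y = 1` determines `Φ`**: `Φ U = Σ_k g_k(splice_C(U, 1)) ·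
conj g_k(Θ_i U)`. -/
theorem apply_eq_sum_of_covariant {i : Fin d} {n : ℕ} {g : Fin n → LGConfig d G → ℂ}
    {Φ : LGConfig d G → ℂ}
    (hcov : ∀ U Y, Φ (configCrossTranslate i Y U) =
      ∑ k, g k (configCrossSplice i U Y) * conj (g k (configLinkReflect i U))) (U : LGConfig d G) :
    Φ U = ∑ k, g k (configCrossSplice i U 1) * conj (g k (configLinkReflect i U)) := by
  rw [← hcov U 1, configCrossTranslate_one]

end Reflect

/-! ## Continuity of the two maps -/

section Continuity

variable [TopologicalSpace G]

/-- `U ↦ splice_C(U, Y)` is continuous. -/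
theorem continuous_configCrossSplice_left (i : Fin d) (Y : LGConfig d G) :
    Continuous fun U : LGConfig d G => configCrossSplice i U Y := by
  refine continuous_pi fun e => ?_
  by_cases he : e.2 = i ∧ e.1 i = 0
  · simp only [configCrossSplice, he, and_self, ↓reduceIte]; exact continuous_const
  · simp only [configCrossSplice, he, ↓reduceIte]; exact continuous_apply e

/-- `Y ↦ splice_C(U, Y)` is continuous. -/
theorem continuous_configCrossSplice_right (i : Fin d) (U : LGConfig d G) :
    Continuous fun Y : LGConfig d G => configCrossSplice i U Y := by
  refine continuous_pi fun e => ?_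
  by_cases he : e.2 = i ∧ e.1 i = 0
  · simp only [configCrossSplice, he, and_self, ↓reduceIte]; exact continuous_apply e
  · simp only [configCrossSplice, he, ↓reduceIte]; exact continuous_const

variable [Group G] [ContinuousMul G]

/-- `U ↦ T_Y U` is continuous. -/
theorem continuous_configCrossTranslate (i : Fin d) (Y : LGConfig d G) :
    Continuous (configCrossTranslate i Y : LGConfig d G → LGConfig d G) := by
  refine continuous_pi fun e => ?_
  by_cases he : e.2 = i ∧ e.1 i = 0
  · simp only [configCrossTranslate, he, and_self, ↓reduceIte]
    exact (continuous_apply e).mul continuous_const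
  · simp only [configCrossTranslate, he, ↓reduceIte]; exact continuous_apply e

end Continuity

/-! ## The covariant link-RP property of a state -/

section Predicate

variable [Group G] [MeasurableSpace G] [TopologicalSpace G]

/-- **Covariant (Osterwalder–Seiler, half-link) link reflection positivity** of a measure `μ` on
`ℤ^d` gauge configurations, in the link mirror `x_i = ½`: for every finite family of bounded
measurable cylinder observables `g_k` supported on the closed half together with the crossing
links (`linkHalfEdges i ∪ linkCrossEdges i`) and every bounded continuous cylinder observable `Φ`
satisfying the covariance identity
`Φ (configCrossTranslate i Y U) = Σ_k g_k (configCrossSplice i U Y) · conj (g_k (configLinkReflect i U))`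
for all `U, Y`, the expectation `∫ Φ dμ` is real and non-negative. This is the shape of the torus
theorems `wilsonExpectation_nonneg_of_covariant` / `wilsonExpectation_nonneg_of_oddCovariant`; a
Wilson loop bisected by the mirror is such a `Φ` with `g_k` the matrix entries of
`ρ(U_c · hol(P) · U_{c'}⁻¹)` (`ClassBLinkCutWordBlocks.lean`). [shape] A parametric definition of a
proposition — NOT a fact; NOT a field of `ClassBState`. [folklore] -/
def IsCovariantLinkRP (i : Fin d) (μ : Measure (LGConfig d G)) : Prop :=
  ∀ (n : ℕ) (g : Fin n → LGConfig d G → ℂ) (T : Finset (ZdEdge d)),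
    (↑T ⊆ linkHalfEdges i ∪ linkCrossEdges i) → (∀ k, Measurable (g k)) →
    (∀ k, IsCylinder (g k) T) → (∃ C : ℝ, ∀ k U, ‖g k U‖ ≤ C) →
    ∀ (Φ : LGConfig d G → ℂ) (S : Finset (ZdEdge d)), IsCylinder Φ S → Continuous Φ →
      (∃ C : ℝ, ∀ U, ‖Φ U‖ ≤ C) →
      (∀ U Y, Φ (configCrossTranslate i Y U) =
        ∑ k, g k (configCrossSplice i U Y) * conj (g k (configLinkReflect i U))) →
      0 ≤ ∫ U, Φ U ∂μ

/-- **Any finite index type.** The covariant link-RP property with the family `g` indexed by an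
arbitrary finite type `K` (reindex along `Fintype.equivFin K`). -/
theorem IsCovariantLinkRP.nonneg_of_fintype {i : Fin d} {μ : Measure (LGConfig d G)}
    (hμ : IsCovariantLinkRP i μ) {K : Type*} [Fintype K] {g : K → LGConfig d G → ℂ}
    {T : Finset (ZdEdge d)} (hT : ↑T ⊆ linkHalfEdges i ∪ linkCrossEdges i)
    (hgm : ∀ k, Measurable (g k)) (hgT : ∀ k, IsCylinder (g k) T) (hgb : ∃ C : ℝ, ∀ k U, ‖g k U‖ ≤ C)
    {Φ : LGConfig d G → ℂ} {S : Finset (ZdEdge d)} (hΦS : IsCylinder Φ S) (hΦc : Continuous Φ)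
    (hΦb : ∃ C : ℝ, ∀ U, ‖Φ U‖ ≤ C)
    (hcov : ∀ U Y, Φ (configCrossTranslate i Y U) =
      ∑ k, g k (configCrossSplice i U Y) * conj (g k (configLinkReflect i U))) :
    0 ≤ ∫ U, Φ U ∂μ := by
  set ε := Fintype.equivFin K with hε
  refine hμ (Fintype.card K) (fun j => g (ε.symm j)) T hT (fun j => hgm _) (fun j => hgT _)
    (hgb.imp fun C hC j U => hC _ U) Φ S hΦS hΦc hΦb fun U Y => ?_
  rw [hcov U Y]
  exact (ε.symm.sum_comp (fun k => g k (configCrossSplice i U Y) *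
    conj (g k (configLinkReflect i U)))).symm

variable [IsTopologicalGroup G]

/-- **The plain pairing is the case `g = F`.** If `μ` has the covariant link-RP property in the
mirror `x_i = ½`, then `0 ≤ ∫ (F∘Θ_i)‾ F dμ` for every bounded continuous (measurable) cylinder
observable `F` supported in the closed half `linkHalfEdges i`: take `Φ = F · (F∘Θ_i)‾`, which is
covariant with the single coefficient `g = F` because neither `F` nor `F∘Θ_i` sees the crossing
links. -/
theorem IsCovariantLinkRP.integral_conj_mul_nonneg_of_cylinder {i : Fin d}
    {μ : Measure (LGConfig d G)} (hμ : IsCovariantLinkRP i μ) {F : LGConfig d G → ℂ}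
    {T : Finset (ZdEdge d)} (hFT : IsCylinder F T) (hT : ↑T ⊆ linkHalfEdges i)
    (hFm : Measurable F) (hFc : Continuous F) {C : ℝ} (hC : ∀ U, ‖F U‖ ≤ C) :
    0 ≤ ∫ U, conj (F (configLinkReflect i U)) * F U ∂μ := by
  have hT' : (↑T : Set (ZdEdge d)) ⊆ linkHalfEdges i ∪ linkCrossEdges i :=
    hT.trans Set.subset_union_left
  have hTc : ∀ e ∈ (↑T : Set (ZdEdge d)), e ∉ linkCrossEdges i := fun e he =>
    not_mem_linkCrossEdges_of_mem_linkHalfEdges (hT he)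
  -- the pairing observable `Φ = F · (F∘Θ)‾` and its cylinder support
  set TΘ : Finset (ZdEdge d) := T.image (fun e => if e.2 = i then
      (zdLinkReflect i e.1 - Pi.single i 1, i) else (zdLinkReflect i e.1, e.2)) with hTΘ
  have hΘcyl : IsCylinder (F ∘ configLinkReflect i) TΘ := isCylinder_comp_configLinkReflect hFT i
  have hΦS : IsCylinder (fun U => F U * conj (F (configLinkReflect i U))) (T ∪ TΘ) := by
    intro U V hUV
    have e1 := hFT fun e he => hUV e (by rw [Finset.coe_union]; exact Or.inl he)
    have e2 := hΘcyl fun e he => hUV e (by rw [Finset.coe_union]; exact Or.inr he)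
    simp only [Function.comp_apply] at e2
    simp only [e1, e2]
  have hΦc : Continuous fun U => F U * conj (F (configLinkReflect i U)) :=
    hFc.mul (Complex.continuous_conj.comp (hFc.comp (continuous_configLinkReflect i)))
  have hΦb : ∃ C' : ℝ, ∀ U, ‖F U * conj (F (configLinkReflect i U))‖ ≤ C' :=
    ⟨C * C, fun U => by
      rw [norm_mul, Complex.norm_conj]
      exact mul_le_mul (hC _) (hC _) (norm_nonneg _) ((norm_nonneg _).trans (hC U))⟩
  have h := hμ 1 (fun _ => F) T hT' (fun _ => hFm) (fun _ => hFT) ⟨C, fun _ U => hC U⟩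
    (fun U => F U * conj (F (configLinkReflect i U))) (T ∪ TΘ) hΦS hΦc hΦb fun U Y => by
      rw [Fin.sum_univ_one, apply_configCrossTranslate_eq hFT hTc,
        apply_configCrossSplice_eq hFT hTc, apply_configLinkReflect_configCrossTranslate_eq hFT hTc]
  simpa only [mul_comm] using h

/-- ★★ **The covariant property implies `ClassB.lean`'s link RP.** For a probability measure `μ`
preserved by the link reflection `Θ_i` (every Class-B / Class-T state, every torus limit point),
`IsCovariantLinkRP i μ` implies `IsReflectionPositiveFor (configLinkReflect i) (linkHalfEdges i) μ`
— reflection positivity for ALL bounded measurable observables of the closed half `{x_i ≥ 1}`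
(the `L²` closure argument `IsReflectionPositiveFor.of_continuous_cylinder`). The converse is not
claimed. -/
theorem IsCovariantLinkRP.linkRP [SecondCountableTopology G] [BorelSpace G] [CompactSpace G]
    [T2Space G] {i : Fin d} {μ : Measure (LGConfig d G)}
    [IsProbabilityMeasure μ] (hμ : IsCovariantLinkRP i μ)
    (hΘ : MeasurePreserving (configLinkReflect i) μ μ) :
    IsReflectionPositiveFor (configLinkReflect i) (linkHalfEdges i) μ := by
  classical
  refine IsReflectionPositiveFor.of_continuous_cylinder hΘ fun F T hFT hFc ⟨C, hC⟩ hFS => ?_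
  have hFT' : IsCylinder F (T.filter (· ∈ linkHalfEdges (d := d) i)) :=
    isCylinder_filter_of_dependsOn hFT hFS
  exact hμ.integral_conj_mul_nonneg_of_cylinder hFT' (fun e he => (Finset.mem_filter.1 he).2)
    hFc.measurable hFc hC

end Predicate

end Summit.QuantumFields.GaugeBoot

end
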